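/-
Copyright: lit-balaban cell, Phase-2 proof seat p11 (gen 6).  Statement-level skeleton of a published paper; no proof claims beyond
what the kernel checks below.
-/
import Literature.MathematicalPhysics.QuantumFieldTheory.BalabanImbrieJaffe1984to88.BIJ85Ineq732General
import Literature.MathematicalPhysics.QuantumFieldTheory.BalabanImbrieJaffe1984to88.BIJ85Ineq732BackgroundFirst

/-!
# `BalabanImbrieJaffe1984to88.BIJ85Ineq732SecondForm` — T. Bałaban, J. Imbrie, A. Jaffe, *Renormalization of the Higgs model:
minimizers, propagators and the stability of mean field theory*, Commun. Math. Phys. **97** (1985) 299–329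
[BalabanImbrieJaffe1985]: Sect. 7.3 p. 326 — **THE SECOND PRINTED FORM OF THE SCALAR STABILITY ESTIMATE (7.3.2)** (*"The second
form of the inequality substitutes v_b for u_k(b) in the covariant derivative of φ"*) AT A GENERAL `U(1)` BACKGROUND, on the torus
model of record, every level `k`, every torus.  For every `U(1)` field `u` on the `η`-lattice whose plaquette variables deviate from `1`
by at most `θ` (`s := L^{2k}θ`) and EVERY unit-lattice `U(1)` field `v` with `κ := max_b |u_k(b) − v_b|` (`u_k(b)` the transport of `u`
along the unit bond `b`, `lineIter u k`):
`⟨ψ, Δ_k(u)ψ⟩ ≥ (γ/2)·Σ_{b∈T₁^{(k)}} |v_bψ(b₊) − ψ(b₋)|² − ((4/3)d⁴s² + γdκ²)·Σ_{x∈T₁^{(k)}} |ψ(x)|²`, `γ = min(a/(9(d+1)), 1/12)` (printed `a_k`,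
physical normalization) — gen 5's first form `BIJ85Ineq732General.ineq732_general_phys` composed with the passage between the two printed
forms (p33's `BIJ85Ineq732BackgroundFirst.bondForm_le_of_close`).  For backgrounds of the product shape `u = W·e^{iθ}` whose `W`-transports
along unit bonds ARE `v` (e.g. `W = Q^{s*}_kv`, (4.5.3): p33's `lineIter_qsstarGIter`) the defect `v_b^{−1}u_k(b)` is `exp(i·θ(b))` with `θ(b)`
THE LINE SUM of the phase over the `L^k` `η`-bonds of `b` (`lineSumIter θ k`), so `κ ≤ max_b |θ(b)|`: only the LINE SUMS of the phase along
unit bonds enter — not its sup-norm (the sup-norm of the (4.5.4) phase `−e_kη𝒟_k∂^*Q^{e*}_kf^{(k)}` is NOT uniformly small: p09's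
`BIJ85Eq454PhaseLowerBound.exists_large_bond`).  File A of the gen-6 member (second printed form) of SKELETON row **C1.Eq7.3.1-7.3.2**
(seat p11 gen 6; file B `BIJ85Claim73SecondForm`: the ACTUAL background (4.5.4) with the operators of record, r15's `Claim73` for the
second-form datum modulo the two located sup-norm constants `K_R` (residual curvature, p33 g7 / p30 g9) and `K_T` (line sums of the phase),
`k = 1` hypothesis-free).

RELATION TO THE OTHER PROVED MEMBERS OF THE ROW.  p33 g6's `BIJ85Ineq732BackgroundStab.ineq732_background_phys` IS the second printed
form at the (4.5.4)-SHAPED background `u = Q^{s*}_kv·e^{iθ}` under the BONDWISE hypothesis `|θ_b| ≤ T`, error `∝ (L^kT)²`; the present file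
assumes instead the gauge-invariant plaquette smallness of `u` (gen 5) plus the smallness of `u_k(b)v_b^{−1}` — for the product shape, of the
LINE SUMS `θ(b) = Σ_{b′⊂b} θ_{b′}` (`|θ(b)| ≤ L^kT` recovers p33's regime, `abs_lineSumIter_le`).  gen 5's `ineq732_general_phys` is the first
printed form; p33's `BIJ85Ineq732BackgroundFirst` the first form at the (4.5.4) shape.

statement-level skeleton of published theorems with citation tags; proofs where landed; nothing here is a claim about the Yang–Mills mass gap

PDF held: `paper:balaban1985-cmp97-bij-higgs-minimizers` (journal page = PDF page + 298).  Pages read this session (`lit read`, OCR text):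
p. 303–304 [PDF 5–6] ((2.6)–(2.17)), p. 311–317 [PDF 13–19] ((4.3.1)–(5.3.1)), p. 326 [PDF 28] ((7.3.1)–(7.3.2)).

CITATION HEADER (lean-in-tree rule).  Phase-2 file of the lit-balaban TYPED SKELETON (HOME `run/shared/lean/pub/lit-balaban/`), seat
p11 gen 6 (unit `lit-balaban-p11-g6`; TAKING line HOME/STATUS.md 2026-08-21T20:03:16Z; owner r15, referee ref-5; free-target protocol
G.5-34(d), own lane).  WHAT IS REPRODUCED: SKELETON row **C1.Eq7.3.1-7.3.2** (`typed p239582`, r15: *"NO printed proof"*), its SECOND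
printed form, as a PROVED MEMBER at a general background.  Objects BY NAME, nothing re-declared: gen 3–5's `lineU`/`lineIter`/`runProd`
(the transports `u_k(b)`, (5.1.2)), gen 4's `bondForm`/`cPhys`, gen 5's `ineq732_general_phys`/`plaqC`, p33's `phase`/`bg454`/`lineIter_mul`/
`lineIter_qsstarGIter`/`bondForm_le_of_close`/`lineIter_bg454`, r18's `corner`/`runBond`/`expU1`/`toC_expU1`, p34's `toC_injective_U1`.
Definitions with bodies (no `def … : Prop`, no named fact; D-0026): `lineSumU`, `lineSumIter` (the line sums of a real `η`-bond function
along the straight unit bonds — the additive form of `lineU`/`lineIter`).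

THE PRINTED TEXT, verbatim (p. 326 [PDF 28]): *"Then the stability estimate can be stated in two forms. For constants γ > 0, α > 0, M < ∞,
⟨φ, Δ_k(u_k)φ⟩ ≥ γ Σ_{b∈T₁^{(k)}} |u_k(b)φ(b₊) − φ(b₋)|² − Me_k^{2−α} Σ_{x∈T₁^{(k)}} |φ(x)|². (7.3.2) The second form of the inequality
substitutes v_b for u_k(b) in the covariant derivative of φ. These inequalities can be proved by an extension of the proofs of [7]."*
p. 312 [PDF 14]: *"(Q^{s*}_kv)_b = 1 if b is strictly contained in a k-block (both endpoints belong to the block), v_c if the η-lattice bond b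
belongs to the corridor of bonds connecting the two blocks B_k(c₋) and B_k(c₊). Here c is a unit lattice bond. (4.5.3)"*; p. 313 [PDF 15]:
*"(u_k)_b = (Q^{s*}_kv)_b exp[−ie_kη(𝒟_k∂^*Q^{e*}_kf^{(k)})_b]. (4.5.4)"*.

WHAT IS PROVED HERE (0 `sorry`, standard axioms).
* §1 `lineSumU`/`lineSumIter` and their calculus: `lineSumIter_smul`, `abs_lineSumIter_le` (`|θ(b)| ≤ (L^k)·max|θ|`), **`lineIter_phase`**
  (`(e^{iθ})_k(b) = e^{iθ(b)}`: the transport of a phase field along the unit bond is the exponential of the line sum),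
  `norm_toC_lineIter_phase_sub_one_le` (`|(e^{iθ})_k(b) − 1| ≤ |θ(b)|`).
* §2 **`ineq732_second_general_phys`**: the display above — the SECOND printed form at a general background `u` (plaquette deviation `≤ θ`),
  for EVERY unit-lattice field `v` with `|u_k(b) − v_b| ≤ κ`, printed `a_k`, physical normalization, constants from `(a, d)` only.
* §3 the product shape: `lineIter_mul_phase` (`(W·e^{iθ})_k(b) = W_k(b)·e^{iθ(b)}`), `norm_toC_lineIter_mul_phase_sub_le` (`W_k = v ⇒
  |u_k(b) − v_b| ≤ |θ(b)|`), and **`ineq732_second_bg454_phys`**: the second printed form at `u = Q^{s*}_kv·e^{iθ}` for EVERY `v` under the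
  plaquette hypothesis on `u` and `|θ(b)| ≤ τ` on the LINE SUMS:
  `(γ/2)·Σ_b |v_bψ(b₊) − ψ(b₋)|² − ((4/3)d⁴(L^{2k}θ₀)² + γdτ²)·‖ψ‖² ≤ ⟨ψ, Δ_k(u)ψ⟩`.
HONEST SCOPE.  (1) As gen 5: the hypotheses sit on the `η`-lattice background (`|u(∂p) − 1| ≤ θ₀`, error `∝ (L^{2k}θ₀)²`) and on the line sums
of the phase; for the ACTUAL background (4.5.4) their derivation from the printed (7.3.1) on `v` is Sect. 7.2 regularity — file B names the
two located constants and discharges them at `k = 1`.  (2) No printed proof exists (*"extension of the proofs of [7]"*); this is a member,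
labelled as such.  (3) Constants not optimized.
-/

open scoped RealInnerProductSpace BigOperators
open Finset Complex

namespace Literature.MathematicalPhysics.QuantumFieldTheory.BalabanImbrieJaffe1984to88.BIJ85Ineq732SecondForm

open Literature.MathematicalPhysics.QuantumFieldTheory.Balaban1983to89
open BIJ88Sect3Statements (U1 toC toC_one toC_mul norm_toC)
open BIJ88Sect3Rescaling (toC_injective_U1)
open BIJ85Sect1Model (HiggsField)
open BIJ85BlockAveragesTorus BIJ85BlockAveragesTorusK BIJ85ScalarPropagatorTorus BIJ85ScalarPropagatorTorusK
open BIJ85ScalarForm464 BIJ85BlockAveragingIneq BIJ85Ineq732Flat BIJ85Ineq732General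
open BIJ85AbelianStokes (plaqC)
open BIJ85HolonomyDeviation (lineIter_mul)
open BIJ85Ineq732PullBack (lineIter_qsstarGIter)
open BIJ85Ineq732Background (phase bg454 bg454_def)
open BIJ85Ineq732BackgroundFirst (bondForm_le_of_close)
open BIJ85Eq453GaugeField (qsstarGIter)

noncomputable section

variable {P : Params} {j : ℕ}

/-! ## §1 Line sums of a real `η`-bond function along the straight unit bonds; the transport of a phase field -/

/-- **The line sum `Σ_{t<L} θ(⟨x + te_μ, μ⟩)` of a real bond function along the straight run of `L` bonds from the corner of `c₋` in the
direction of `c`** — the additive counterpart of the transport `lineU` (`u(Γ_{yy′}) = Π u_b`, (2.5)/(5.1.2)): for `u = e^{iθ}`,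
`u(Γ_{yy′}) = exp(i·lineSumU θ)` (`lineU_phase`). [cite: BalabanImbrieJaffe1985, (5.1.2) p.313] -/
def lineSumU (θ : PBond P j → ℝ) : PBond P (j + 1) → ℝ := fun c => ∑ t ∈ range P.L, θ (runBond (corner c.src) c.dir t)

/-- **The iterated line sums `θ(b)`, `b ∈ T^{(j+k)}`**: the sum of `θ` over the `L^k` `η`-bonds of the straight unit-lattice bond `b` (runs of
runs, as `lineIter`): `lineSumIter θ 0 = θ`, `lineSumIter θ (k+1) = lineSumU (lineSumIter θ k)`. [cite: BalabanImbrieJaffe1985, (5.1.2) p.313] -/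
def lineSumIter (θ : PBond P j → ℝ) : (k : ℕ) → PBond P (j + k) → ℝ
  | 0 => θ
  | k + 1 => lineSumU (lineSumIter θ k)

/-- kernel: `lineSumIter θ 0 = θ`. [cite: BalabanImbrieJaffe1985, (5.1.2) p.313] -/
@[simp] theorem lineSumIter_zero (θ : PBond P j → ℝ) : lineSumIter θ 0 = θ := rfl

/-- kernel: `lineSumIter θ (k+1) = lineSumU (lineSumIter θ k)`. [cite: BalabanImbrieJaffe1985, (5.1.2) p.313] -/
@[simp] theorem lineSumIter_succ (θ : PBond P j → ℝ) (k : ℕ) : lineSumIter θ (k + 1) = lineSumU (lineSumIter θ k) := rfl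

/-- kernel: the line sum is linear — `lineSumU (aθ) = a·lineSumU θ`. [cite: BalabanImbrieJaffe1985, (5.1.2) p.313] -/
theorem lineSumU_smul (a : ℝ) (θ : PBond P j → ℝ) : lineSumU (fun b => a * θ b) = fun c => a * lineSumU θ c := by
  funext c
  simp [lineSumU, mul_sum]

/-- kernel: `lineSumIter (aθ) k = a·lineSumIter θ k`. [cite: BalabanImbrieJaffe1985, (5.1.2) p.313] -/
theorem lineSumIter_smul (a : ℝ) (θ : PBond P j → ℝ) : ∀ k : ℕ, lineSumIter (fun b => a * θ b) k = fun c => a * lineSumIter θ k c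
  | 0 => rfl
  | k + 1 => by rw [lineSumIter_succ, lineSumIter_smul a θ k, lineSumU_smul]; rfl

/-- kernel: `lineSumIter (−θ) k = −lineSumIter θ k`. [cite: BalabanImbrieJaffe1985, (5.1.2) p.313] -/
theorem lineSumIter_neg (θ : PBond P j → ℝ) (k : ℕ) : lineSumIter (fun b => -θ b) k = fun c => -lineSumIter θ k c := by
  have h := lineSumIter_smul (-1) θ k
  simp only [neg_mul, one_mul] at h
  exact h

/-- kernel: `|lineSumU θ(c)| ≤ L·T` if `|θ| ≤ T` bondwise. [cite: BalabanImbrieJaffe1985, (5.1.2) p.313] -/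
theorem abs_lineSumU_le {θ : PBond P j → ℝ} {T : ℝ} (h : ∀ b, |θ b| ≤ T) (c : PBond P (j + 1)) : |lineSumU θ c| ≤ P.L * T := by
  unfold lineSumU
  calc |∑ t ∈ range P.L, θ (runBond (corner c.src) c.dir t)| ≤ ∑ t ∈ range P.L, |θ (runBond (corner c.src) c.dir t)| :=
        abs_sum_le_sum_abs _ _
    _ ≤ ∑ _t ∈ range P.L, T := sum_le_sum fun t _ => h _
    _ = P.L * T := by rw [sum_const, card_range, nsmul_eq_mul]

/-- kernel: **`|θ(b)| ≤ L^k·max|θ|`** — the line sum over the `L^k` bonds of a unit bond (so a bondwise bound `|θ| ≤ T` gives p33's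
`τ = L^kT`). [cite: BalabanImbrieJaffe1985, (5.1.2) p.313] -/
theorem abs_lineSumIter_le {θ : PBond P j → ℝ} {T : ℝ} (h : ∀ b, |θ b| ≤ T) :
    ∀ (k : ℕ) (c : PBond P (j + k)), |lineSumIter θ k c| ≤ (P.L : ℝ) ^ k * T
  | 0, c => by simpa using h c
  | k + 1, c => by
    rw [lineSumIter_succ, pow_succ, mul_comm ((P.L : ℝ) ^ k), mul_assoc]
    exact abs_lineSumU_le (abs_lineSumIter_le h k) c

/-- kernel: the transport of the phase field `e^{iθ}` along `Γ_{yy′}` is `exp(i·lineSumU θ)` — `Π_t e^{iθ_t} = e^{iΣ_tθ_t}` (abelian).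
[cite: BalabanImbrieJaffe1985, (5.1.2) p.313] -/
theorem lineU_phase (θ : PBond P j → ℝ) : lineU (phase θ) = phase (lineSumU θ) := by
  funext c
  apply toC_injective_U1
  rw [lineU, toC_runProd]
  show ∏ t ∈ range P.L, toC (BIJ85BlockAveragesTorus.expU1 (θ (runBond (corner c.src) c.dir t))) =
    toC (BIJ85BlockAveragesTorus.expU1 (lineSumU θ c))
  simp_rw [toC_expU1]
  rw [← Complex.exp_sum, lineSumU]
  congr 1
  push_cast
  rw [sum_mul]

/-- **`(e^{iθ})_k(b) = e^{iθ(b)}`**: the transport of a phase field along the unit-lattice bond `b` (`L^k` `η`-bonds) is the exponential of the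
LINE SUM `θ(b) = lineSumIter θ k b`. [cite: BalabanImbrieJaffe1985, (5.1.2) p.313] -/
theorem lineIter_phase (θ : PBond P j → ℝ) : ∀ k : ℕ, lineIter (phase θ) k = phase (lineSumIter θ k)
  | 0 => rfl
  | k + 1 => by rw [lineIter_succ, lineIter_phase θ k, lineU_phase, lineSumIter_succ]

/-- kernel: `|(e^{iθ})_k(b) − 1| ≤ |θ(b)|` (`|e^{it} − 1| ≤ |t|`). [cite: BalabanImbrieJaffe1985, (7.3.2) p.326] -/
theorem norm_toC_lineIter_phase_sub_one_le (θ : PBond P j → ℝ) (k : ℕ) (c : PBond P (j + k)) :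
    ‖toC (lineIter (phase θ) k c) - 1‖ ≤ |lineSumIter θ k c| := by
  rw [lineIter_phase]
  show ‖toC (BIJ85BlockAveragesTorus.expU1 (lineSumIter θ k c)) - 1‖ ≤ _
  rw [toC_expU1]
  have h := Real.norm_exp_I_mul_ofReal_sub_one_le (x := lineSumIter θ k c)
  rw [mul_comm Complex.I] at h
  rwa [Real.norm_eq_abs] at h

/-! ## §2 The second printed form of (7.3.2) at a general background -/

/-- **(7.3.2), SECOND PRINTED FORM, AT A GENERAL BACKGROUND**: for `1 ≤ k`, `j + k ≤ m + K`, `a > 0`, every `U(1)` field `u` on the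
`η`-lattice with plaquette variables within `θ` of `1`, `G` the inverse (4.6.2) at `u` (physical normalization `cPhys`, printed `a_k`), EVERY
unit-lattice `U(1)` field `v` with `|u_k(b) − v_b| ≤ κ` for all unit bonds `b` (`u_k(b)` = the transport of `u` along `b`), and every `ψ`:
`(γ/2)·Σ_{b∈T₁^{(k)}} |v_bψ(b₊) − ψ(b₋)|² − ((4/3)d⁴(L^{2k}θ)² + γ·d·κ²)·‖ψ‖² ≤ ⟨ψ, Δ_k(u)ψ⟩`, `γ = min(a/(9(d+1)), 1/12)` — gen 5's first form
`ineq732_general_phys` and `Σ_b|v_bψ(b₊) − ψ(b₋)|² ≤ 2Σ_b|u_k(b)ψ(b₊) − ψ(b₋)|² + 2κ²d‖ψ‖²` (p33's `bondForm_le_of_close`).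
[cite: BalabanImbrieJaffe1985, (7.3.2) p.326] -/
theorem ineq732_second_general_phys {k : ℕ} (hk1 : 1 ≤ k) (hk : j + k ≤ P.m + P.K) {a : ℝ} (ha : 0 < a) (U : GaugeField P j U1)
    {θ : ℝ} (hθ : ∀ (x : Balaban1983to89.Site P j) (μ ν : Fin P.d), ‖plaqC U x μ ν - 1‖ ≤ θ)
    {G : FineSp P j →ₗ[ℝ] FineSp P j}
    (hG : ∀ φ, opT (Dlin (cPhys P k) U) (QlinK U k) (BIJ85Sect4Statements.aK a P.L k) (G φ) = φ)
    (V : GaugeField P (j + k) U1) {κ : ℝ} (hκ : ∀ c, ‖toC (lineIter U k c) - toC (V c)‖ ≤ κ)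
    (ψ : CoarseSpK P j k) :
    min (a / (9 * (P.d + 1))) (1 / 12) / 2 * bondForm V ψ
        - (4 / 3 * (P.d : ℝ) ^ 4 * (((P.L : ℝ) ^ k) ^ 2 * θ) ^ 2 + min (a / (9 * (P.d + 1))) (1 / 12) * P.d * κ ^ 2) * ‖ψ‖ ^ 2
      ≤ ⟪ψ, deltaOp (QlinK U k) (BIJ85Sect4Statements.aK a P.L k) G ψ⟫ := by
  have h1 := ineq732_general_phys hk1 hk ha U hθ hG ψ
  have hκ' : ∀ c, ‖toC (V c) - toC (lineIter U k c)‖ ≤ κ := fun c => by rw [norm_sub_rev]; exact hκ c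
  have h2 := bondForm_le_of_close V (lineIter U k) hκ' ψ
  have hγ0 : 0 ≤ min (a / (9 * ((P.d : ℝ) + 1))) (1 / 12) := le_min (by positivity) (by norm_num)
  have h3 := mul_le_mul_of_nonneg_left h2 hγ0
  nlinarith [h1, h3]

/-- The same with the error on `Σ_x |ψ(x)|²` (the printed right-hand sum). [cite: BalabanImbrieJaffe1985, (7.3.2) p.326] -/
theorem ineq732_second_general_phys' {k : ℕ} (hk1 : 1 ≤ k) (hk : j + k ≤ P.m + P.K) {a : ℝ} (ha : 0 < a) (U : GaugeField P j U1)
    {θ : ℝ} (hθ : ∀ (x : Balaban1983to89.Site P j) (μ ν : Fin P.d), ‖plaqC U x μ ν - 1‖ ≤ θ)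
    {G : FineSp P j →ₗ[ℝ] FineSp P j}
    (hG : ∀ φ, opT (Dlin (cPhys P k) U) (QlinK U k) (BIJ85Sect4Statements.aK a P.L k) (G φ) = φ)
    (V : GaugeField P (j + k) U1) {κ : ℝ} (hκ : ∀ c, ‖toC (lineIter U k c) - toC (V c)‖ ≤ κ)
    (ψ : CoarseSpK P j k) :
    min (a / (9 * (P.d + 1))) (1 / 12) / 2 * bondForm V ψ
        - (4 / 3 * (P.d : ℝ) ^ 4 * (((P.L : ℝ) ^ k) ^ 2 * θ) ^ 2 + min (a / (9 * (P.d + 1))) (1 / 12) * P.d * κ ^ 2)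
          * ∑ x : Balaban1983to89.Site P (j + k), ‖ψ x‖ ^ 2
      ≤ ⟪ψ, deltaOp (QlinK U k) (BIJ85Sect4Statements.aK a P.L k) G ψ⟫ := by
  rw [sum_norm_sq_eq ψ]
  exact ineq732_second_general_phys hk1 hk ha U hθ hG V hκ ψ

/-! ## §3 Backgrounds of the product shape `u = W·e^{iθ}`: only the line sums of the phase enter -/

/-- **`(W·e^{iθ})_k(b) = W_k(b)·e^{iθ(b)}`** — transports of a product are products of transports (abelian; p33's `lineIter_mul`) and
§1's `lineIter_phase`. [cite: BalabanImbrieJaffe1985, (4.5.4) p.313] -/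
theorem lineIter_mul_phase (W : GaugeField P j U1) (θ : PBond P j → ℝ) (k : ℕ) :
    lineIter (fun b => W b * phase θ b) k = fun c => lineIter W k c * phase (lineSumIter θ k) c := by
  rw [lineIter_mul, lineIter_phase]

/-- **If the `W`-transports along unit bonds are `v` then `|u_k(b) − v_b| ≤ |θ(b)|` for `u = W·e^{iθ}`** (`|W_k(b)| = 1`,
`|e^{iθ(b)} − 1| ≤ |θ(b)|`). [cite: BalabanImbrieJaffe1985, (7.3.2) p.326] -/
theorem norm_toC_lineIter_mul_phase_sub_le (W : GaugeField P j U1) (θ : PBond P j → ℝ) (k : ℕ) {V : GaugeField P (j + k) U1}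
    (hW : lineIter W k = V) (c : PBond P (j + k)) :
    ‖toC (lineIter (fun b => W b * phase θ b) k c) - toC (V c)‖ ≤ |lineSumIter θ k c| := by
  rw [lineIter_mul_phase, hW, toC_mul, ← lineIter_phase]
  have e : toC (V c) * toC (lineIter (phase θ) k c) - toC (V c) = toC (V c) * (toC (lineIter (phase θ) k c) - 1) := by ring
  rw [e, norm_mul, norm_toC, one_mul]
  exact norm_toC_lineIter_phase_sub_one_le θ k c

/-- **(4.5.3) ⇒ the `Q^{s*}_kv`-transport along a unit bond is `v_b`, so for `u = Q^{s*}_kv·e^{iθ}`: `|u_k(b) − v_b| ≤ |θ(b)|`** (p33's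
`lineIter_qsstarGIter`; standing range). [cite: BalabanImbrieJaffe1985, (4.5.3) p.312] -/
theorem norm_toC_lineIter_bg454_sub_le {k : ℕ} (hk : j + k ≤ P.m + P.K) (v : GaugeField P (j + k) U1) (θ : PBond P j → ℝ)
    (c : PBond P (j + k)) :
    ‖toC (lineIter (bg454 k v θ) k c) - toC (v c)‖ ≤ |lineSumIter θ k c| := by
  rw [bg454_def]
  exact norm_toC_lineIter_mul_phase_sub_le (qsstarGIter k v) θ k (lineIter_qsstarGIter k hk v) c

/-- **(7.3.2), SECOND PRINTED FORM, AT THE (4.5.4)-SHAPED BACKGROUND `u = Q^{s*}_kv·e^{iθ}` UNDER THE PLAQUETTE HYPOTHESIS ON `u` AND A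
BOUND ON THE LINE SUMS OF THE PHASE**: for `1 ≤ k`, `j + k ≤ m + K`, `a > 0`, EVERY unit-lattice `U(1)` field `v`, every real `η`-bond function
`θ` with `|u(∂p) − 1| ≤ θ₀` for all oriented `η`-plaquettes of `u` and `|θ(b)| ≤ τ` for the line sum along every unit bond `b`, `G` the inverse
(4.6.2) at `u` (physical normalization, printed `a_k`), every `ψ`:
`(γ/2)·Σ_{b∈T₁^{(k)}} |v_bψ(b₊) − ψ(b₋)|² − ((4/3)d⁴(L^{2k}θ₀)² + γdτ²)·Σ_x|ψ(x)|² ≤ ⟨ψ, Δ_k(u)ψ⟩`, `γ = min(a/(9(d+1)), 1/12)`.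
[cite: BalabanImbrieJaffe1985, (7.3.2) p.326] -/
theorem ineq732_second_bg454_phys {k : ℕ} (hk1 : 1 ≤ k) (hk : j + k ≤ P.m + P.K) {a : ℝ} (ha : 0 < a)
    (v : GaugeField P (j + k) U1) (θ : PBond P j → ℝ)
    {θ₀ : ℝ} (hθ₀ : ∀ (x : Balaban1983to89.Site P j) (μ ν : Fin P.d), ‖plaqC (bg454 k v θ) x μ ν - 1‖ ≤ θ₀)
    {τ : ℝ} (hτ : ∀ c : PBond P (j + k), |lineSumIter θ k c| ≤ τ)
    {G : FineSp P j →ₗ[ℝ] FineSp P j}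
    (hG : ∀ φ, opT (Dlin (cPhys P k) (bg454 k v θ)) (QlinK (bg454 k v θ) k) (BIJ85Sect4Statements.aK a P.L k) (G φ) = φ)
    (ψ : CoarseSpK P j k) :
    min (a / (9 * (P.d + 1))) (1 / 12) / 2 * bondForm v ψ
        - (4 / 3 * (P.d : ℝ) ^ 4 * (((P.L : ℝ) ^ k) ^ 2 * θ₀) ^ 2 + min (a / (9 * (P.d + 1))) (1 / 12) * P.d * τ ^ 2)
          * ∑ x : Balaban1983to89.Site P (j + k), ‖ψ x‖ ^ 2
      ≤ ⟪ψ, deltaOp (QlinK (bg454 k v θ) k) (BIJ85Sect4Statements.aK a P.L k) G ψ⟫ :=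
  ineq732_second_general_phys' hk1 hk ha (bg454 k v θ) hθ₀ hG v
    (fun c => (norm_toC_lineIter_bg454_sub_le hk v θ c).trans (hτ c)) ψ

end

end Literature.MathematicalPhysics.QuantumFieldTheory.BalabanImbrieJaffe1984to88.BIJ85Ineq732SecondForm
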